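import Summits.QuantumFields.YangMills.Theorems.BalabanUVNodesN11SpaceTruncationChargedFibre
import Summits.QuantumFields.YangMills.Theorems.BalabanUVNodesN11Data7OnFibre

/-!
# DAG node N11 — THE NO-EXPANSION 𝐓-STEP AT CHARGED SEPARATED INDICES WITH THE JUNCTION ASKED ON THE ITERATED AVERAGING FIBRE ONLY (p595777 re-keyed)

HEADER — WORK-UNIT METADATA.  Cell `pub-ymgap`, YM-PLAN Track A (HUMAN RULING D-0062), seat `pub-ymgap-dag-n11-d` (g13; R134 fan-out seat N11 [B14], strategy s2),
route `BalabanUVNodes`, item K1⁷ `StabilityBAtRecordR13SepCoPH` = stmt-QuantumFields-20542 (helper, `--kind proof --supports 20542 --as helper`, count-neutral).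
[III] = [Balaban1988Convergent], [6] = [Balaban1985RegularSpaces].  Over p595777 `…N11SpaceTruncationChargedSep` (re-keyed here), g13's `…N11SpaceTruncationChargedFibre`
(the two record faces over the charged ITERATED FIBRE) and dag-n11-e g6's `B14SeparationOfRecord` (`seqSeparated_of_slotsOfRecord₁₃_ne_zero_of_M₁_le_M`).

WHY THIS FILE.  p595777 keys the no-expansion 𝐓-step on the record row `Provisos₁₃SepCoPH.bg` plus the JUNCTION «charged ∧ separated ⇒ every `Wc` with `χ_k(s₀)(Wc k) ≠ 0` and
regular lower scales lies in the separated (7)-regular support».  Since 11a's `𝐓_k(s₀)` reads its operand, for a.e. `V_k`, only on the iterated averaging fibre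
(`…TkIteratedFibreReading(Slot)`), the junction need only be asked at fibre configurations (`Wc j ≡ 1` off `bondsIn j (Ω_{j+1})ᶜ`, `avg(Wc j) = Wc (j+1)` on
`bondsIn (j+1) (Ω_{j+1})ᶜ`) — where its (7)-data half is a theorem (`…N11Data7OnFibre`); the sequel `…N11ChargedSepJunctionOfSolvableFibre` cashes that in.

WHAT THIS FILE PROVES (0 `sorry`, 0 `def`).  `bgProvisoΛ_chargedFibre_of_sep_of_junctionFibre`; ★★ `exists_local_witness_clause_succ_of_sLaw₁₃CoPH_of_sep_of_junctionFibre` ∕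
★★ `exists_local_witness_clause_succ_of_hasSect2FormAtZS_of_borelB_of_sep_of_junctionFibre` — p595777's two faces, conclusions VERBATIM, hJ asked on the fibre only.

HONEST FRAMING.  Helper lane of K1⁷; composition; nothing of Bałaban's is asserted (the junction remains a displayed hypothesis here, discharged to its top clause in the sequel).
N11 NOT discharged; K1⁷ NOT closed; counts unmoved (typed 28∕28 · discharged 5∕27).  One finite four-torus programme at fixed `ε = L^{−K}` — NOT ℝ⁴, NOT OS, NOT a mass gap,
NOT Clay.  No `sorry`, `axiom`, `def`, `instance`, `notation`.  Sources (SHAPE only): [III] Theorem p.245, (2.1) p.254, (2.7) p.255, (2.10) p.256, (2.28) p.259, Thm 1 p.262,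
(3.5) p.265, (3.24)–(3.25) p.270; [6] (1.3)–(1.6) p.77.
-/

noncomputable section

open MeasureTheory
open scoped BigOperators ENNReal NNReal Matrix.Norms.L2Operator

namespace Summit.QuantumFields.YangMills.Theorems.BalabanUVNodesN11ChargedSepJunctionFibre

open Literature.MathematicalPhysics.QuantumFieldTheory.Balaban1983to89 T4Continuum T4NestedCovariance Node00 Node00.Tk DagBinding
open B15DeterminingSets B8Eq17ClassAkV1 B10Eq42TorusConstraint
open BalabanUVNodesN11FluctTruncationDefs (IsFluctLocal)
open BalabanUVNodesN11SpaceTruncationDefs BalabanUVNodesN11SpaceTruncationBorelBDefs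
open BalabanUVNodesN11SpaceTruncationChargedFibre (exists_local_witness_clause_succ_of_sLaw₁₃CoPH_of_bgReadChargedFibre
  exists_local_witness_clause_succ_of_hasSect2FormAtZS_of_borelB_of_bgReadChargedFibre)
open B14SeparationOfRecord (seqSeparated_of_slotsOfRecord₁₃_ne_zero_of_M₁_le_M)

variable {F : T4Family} {N : ℕ} [NeZero N]

variable (θ : Stage13HParams F N) (p : B12.RunParams)

/-- **THE CHARGED ITERATED-FIBRE PROVISO FROM THE RECORD ROW AND THE JUNCTION ON THE FIBRE AT CHARGED SEPARATED INDICES**: under the grid comparison `0 < M₁ ≤ M`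
a charged index is `Sect2.SeqSeparated` (dag-n11-e g6), so def-R's `BgProvisoΛ` over the separated (7)-regular support plus the junction «charged ∧ separated ⇒
(χ-support × lower-scale regularity on the reading regions ⊆ separated (7)-regular support)» give `BgProvisoΛ` over the CHARGED ITERATED FIBRE at every index (the junction asked only at fibre configurations).
[cite: Balaban1988Convergent, (2.28) p.259, (2.10) p.256, (2.1) p.254, (3.5) p.265; Balaban1985RegularSpaces, (1.3)–(1.6) p.77] -/
theorem bgProvisoΛ_chargedFibre_of_sep_of_junctionFibre (hM₁ : 0 < θ.ν.M₁) (hle : θ.ν.M₁ ≤ θ.τ9.M) {k : ℕ} (cR : ℝ)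
    (Γr : SeqOfRecord F θ.ν θ.τ9.M (gOfRecord₁₃ F N θ.toStage13Params p) p.K k → ℕ → Set (Site (F.P p.K) 0) → Set (Site (F.P p.K) 0))
    (hsep : BgProvisoΛ F N p.K (settingOfRecord₁₃ F N θ.toStage13Params p) (θ.Rz p.K) θ.τ9.M k (suppOfRecord₁₃SepCoP F N θ.toStage13Params p k)
      (UbgOfRecord₁₃CoP F N θ.toStage13Params p k))
    (hJ : ∀ s₀, slotsOfRecord F N θ.ν θ.τ9 (EOfRecord₁₃ F N θ.toStage13Params) (wOfRecord₉ F N θ.toStage9Params) θ.ppSel p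
        (gOfRecord₁₃ F N θ.toStage13Params p) k s₀ ≠ 0 → Sect2.SeqSeparated θ.ν.M₁ s₀ → ∀ Wc : MSField (F.P p.K) (SU N),
      chiSeqOfRecord F N θ.ν θ.τ9.M (gOfRecord₁₃ F N θ.toStage13Params p) p.K k s₀ (Wc k) ≠ 0 →
      (∀ j, j < k → PlaqSmallOn (plaqsOf (pts j (Γr s₀ j (s₀.Ω (j + 1))ᶜ))) (cR * epsOfRecord θ.ν (gOfRecord₁₃ F N θ.toStage13Params p) j) (Wc j)) →
      (∀ j, j < k → ∀ b : PBond (F.P p.K) j, b ∉ bondsIn j (s₀.Ω (j + 1))ᶜ → Wc j b = 1) →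
      (∀ j, j < k → ∀ b : PBond (F.P p.K) (j + 1), b ∈ bondsIn (j + 1) (s₀.Ω (j + 1))ᶜ → (avOfRecord F N p.K j).avg (Wc j) b = Wc (j + 1) b) →
      Wc ∈ suppOfRecord₁₃SepCoP F N θ.toStage13Params p k s₀) :
    BgProvisoΛ F N p.K (settingOfRecord₁₃ F N θ.toStage13Params p) (θ.Rz p.K) θ.τ9.M k
      (fun s₀ => {Wc | slotsOfRecord F N θ.ν θ.τ9 (EOfRecord₁₃ F N θ.toStage13Params) (wOfRecord₉ F N θ.toStage9Params) θ.ppSel p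
          (gOfRecord₁₃ F N θ.toStage13Params p) k s₀ ≠ 0 ∧
        chiSeqOfRecord F N θ.ν θ.τ9.M (gOfRecord₁₃ F N θ.toStage13Params p) p.K k s₀ (Wc k) ≠ 0 ∧
        (∀ j, j < k → PlaqSmallOn (plaqsOf (pts j (Γr s₀ j (s₀.Ω (j + 1))ᶜ))) (cR * epsOfRecord θ.ν (gOfRecord₁₃ F N θ.toStage13Params p) j) (Wc j)) ∧
        (∀ j, j < k → ∀ b : PBond (F.P p.K) j, b ∉ bondsIn j (s₀.Ω (j + 1))ᶜ → Wc j b = 1) ∧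
        (∀ j, j < k → ∀ b : PBond (F.P p.K) (j + 1), b ∈ bondsIn (j + 1) (s₀.Ω (j + 1))ᶜ → (avOfRecord F N p.K j).avg (Wc j) b = Wc (j + 1) b)})
      (UbgOfRecord₁₃CoP F N θ.toStage13Params p k) := by
  intro s₀ Wc hWc j h1 hj X
  exact hsep s₀ Wc (hJ s₀ hWc.1 (seqSeparated_of_slotsOfRecord₁₃_ne_zero_of_M₁_le_M F N p θ.toStage13Params hM₁ hle s₀ hWc.1) Wc hWc.2.1 hWc.2.2.1 hWc.2.2.2.1
    hWc.2.2.2.2) j h1 hj X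

/-- **★★ THE SLaw-KEYED FACE AT THE CHARGED SEPARATED INDICES WITH THE JUNCTION ASKED ON THE ITERATED FIBRE ONLY**: `…SpaceTruncationChargedFibre`'s ★★★ keyed on the record row `Provisos₁₃SepCoPH.bg`
(window + `PartCompat₁₃`), the junction hJ at CHARGED SEPARATED indices ON THE ITERATED FIBRE, 12a″'s `RegOn`, the run rows and `0 < M₁ ≤ M`; conclusion
VERBATIM p595777's. [cite: Balaban1988Convergent, Theorem p.245, Thm 1 p.262, (2.1) p.254, (2.7) p.255, (2.10) p.256, (2.28) p.259, (3.5) p.265, (3.24)–(3.25) p.270; Balaban1985RegularSpaces, (1.3)–(1.6) p.77] -/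
theorem exists_local_witness_clause_succ_of_sLaw₁₃CoPH_of_sep_of_junctionFibre (hsep : θ.Provisos₁₃SepCoPH F N) (hU : θ.ZhUnity F N) (hθ : θ.Admissible F N)
    (hpos : θ.s2.Pos) (hM₁ : 0 < θ.ν.M₁) (hle : θ.ν.M₁ ≤ θ.τ9.M) {k : ℕ} (hk : k < p.K) (hM : 1 ≤ θ.τ9.M)
    (hw : Step.InInterval θ.γ k (gOfRecord₁₃ F N θ.toStage13Params p)) (hPC : PartCompat₁₃ F N θ.toStage13Params p k) (cR : ℝ)
    (Γr : SeqOfRecord F θ.ν θ.τ9.M (gOfRecord₁₃ F N θ.toStage13Params p) p.K k → ℕ → Set (Site (F.P p.K) 0) → Set (Site (F.P p.K) 0))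
    (hreg : ∀ s₀, (θ.zhAt p s₀).RegOn F N (FluctV N) θ.ν cR p (gOfRecord₁₃ F N θ.toStage13Params p) (Γr s₀))
    (hJ : ∀ s₀, slotsOfRecord F N θ.ν θ.τ9 (EOfRecord₁₃ F N θ.toStage13Params) (wOfRecord₉ F N θ.toStage9Params) θ.ppSel p
        (gOfRecord₁₃ F N θ.toStage13Params p) k s₀ ≠ 0 → Sect2.SeqSeparated θ.ν.M₁ s₀ → ∀ Wc : MSField (F.P p.K) (SU N),
      chiSeqOfRecord F N θ.ν θ.τ9.M (gOfRecord₁₃ F N θ.toStage13Params p) p.K k s₀ (Wc k) ≠ 0 →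
      (∀ j, j < k → PlaqSmallOn (plaqsOf (pts j (Γr s₀ j (s₀.Ω (j + 1))ᶜ))) (cR * epsOfRecord θ.ν (gOfRecord₁₃ F N θ.toStage13Params p) j) (Wc j)) →
      (∀ j, j < k → ∀ b : PBond (F.P p.K) j, b ∉ bondsIn j (s₀.Ω (j + 1))ᶜ → Wc j b = 1) →
      (∀ j, j < k → ∀ b : PBond (F.P p.K) (j + 1), b ∈ bondsIn (j + 1) (s₀.Ω (j + 1))ᶜ → (avOfRecord F N p.K j).avg (Wc j) b = Wc (j + 1) b) →
      Wc ∈ suppOfRecord₁₃SepCoP F N θ.toStage13Params p k s₀)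
    (hS : SLaw₁₃CoPH F N θ p k) :
    ∃ (t : SeqOfRecord F θ.ν θ.τ9.M (gOfRecord₁₃ F N θ.toStage13Params p) p.K k → Sect2.TermValues (F.P p.K) (MatA N) (FluctV N) θ.τ9.M)
      (Ek : SeqOfRecord F θ.ν θ.τ9.M (gOfRecord₁₃ F N θ.toStage13Params p) p.K k → ℝ),
      HasSect2FormAtZS F N (FluctV N) p.K (settingOfRecord₁₃ F N θ.toStage13Params p) k (θ.rzAt p) (WtOfRecord₁₃H F N θ p)
          (UbgOfRecord₁₃CoP F N θ.toStage13Params p k)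
          (fun s₀ t₀ => Sect2.LawsRT (sect2TowerOfRecord F N (FluctV N) p.K (settingOfRecord₁₃ F N θ.toStage13Params p) (θ.rzAt p s₀) s₀ t₀)
            (settingOfRecord₁₃ F N θ.toStage13Params p).lf k)
          (slotsOfRecord F N θ.ν θ.τ9 (EOfRecord₁₃ F N θ.toStage13Params) (wOfRecord₉ F N θ.toStage9Params) θ.ppSel p
            (gOfRecord₁₃ F N θ.toStage13Params p) k) t Ek ∧
      (∀ s₀, IsFluctLocal k (t s₀)) ∧
      ∀ (s : SeqOfRecord F θ.ν θ.τ9.M (gOfRecord₁₃ F N θ.toStage13Params p) p.K (k + 1)), s.Ω (k + 1) = ∅ →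
        -- (P) prefix agreement below `k`
        (∀ j, j < k → (θ.zhAt p s).ζ0 j = (θ.zhAt p s.init).ζ0 j ∧ (θ.zhAt p s).quad j = (θ.zhAt p s.init).quad j) →
        -- (V) the generation-`k` pin with the old front factor
        (∀ (V' : GaugeField (F.P p.K) (k + 1) (SU N)) (U₀ : GaugeField (F.P p.K) k (SU N)),
          (θ.zhAt p s).ζ0 k Set.univ (pairCfgAt (V := FluctV N) k V' U₀) =
            chiSeqOfRecord F N θ.ν θ.τ9.M (gOfRecord₁₃ F N θ.toStage13Params p) p.K k s.init U₀ *
              wOfRecord₉ F N θ.toStage9Params p (gOfRecord₁₃ F N θ.toStage13Params p) k s U₀ ((avOfRecord F N p.K k).avg U₀)) →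
        -- `quad_k(∅) = 0` on the two-scale configurations
        (∀ (V' : GaugeField (F.P p.K) (k + 1) (SU N)) (U₀ : GaugeField (F.P p.K) k (SU N)), (θ.zhAt p s).quad k ∅ (pairCfgAt (V := FluctV N) k V' U₀) = 0) →
        -- `k`-locality of `quad_j(Λ_{j+1})`, `j < k`
        (∀ j, j < k → ∀ ω ω' : MultiCfg (F.P p.K) (SU N) (FluctV N), (∀ i, i ≤ k → ω i = ω' i) →
          (θ.zhAt p s).quad j (s.init.Λ (j + 1)) ω = (θ.zhAt p s).quad j (s.init.Λ (j + 1)) ω') →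
        -- measurability of the residual serving `s′`
        (∀ j (Y : Set (Site (F.P p.K) 0)), Measurable ((θ.zhAt p s).ζ0 j Y)) →
        (∀ j (Λ' : Set (Site (F.P p.K) 0)), Measurable ((θ.zhAt p s).quad j Λ')) →
        -- per old branch: A-fibre domination (K0b)
        (∀ S ∈ admSOfRecord F θ.ν θ.τ9.M (gOfRecord₁₃ F N θ.toStage13Params p) p.K k s.init, ∀ j : ℕ,
          ∃ ŵ : (↥(Set.toFinite (B10Eq42TorusConstraint.bondsIn j ((s.init.Λ (j + 1))ᶜ ∩ s.init.Ω (j + 1)))).toFinset → FluctV N) → ℝ≥0∞, Measurable ŵ ∧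
            (∫⁻ a, ŵ a ∂(Measure.pi fun _ : ↥(Set.toFinite (B10Eq42TorusConstraint.bondsIn j ((s.init.Λ (j + 1))ᶜ ∩ s.init.Ω (j + 1)))).toFinset => (volume : Measure (FluctV N)))) ≠ ⊤ ∧
            ∀ ω, ENNReal.ofReal ((WtOfRecord₁₃H F N θ p s).w j (s.init.Λ (j + 1)) ((s.init.Λ (j + 1))ᶜ ∩ s.init.Ω (j + 1)) (S (j + 1)) ω) ≤
              ŵ (fun b : ↥(Set.toFinite (B10Eq42TorusConstraint.bondsIn j ((s.init.Λ (j + 1))ᶜ ∩ s.init.Ω (j + 1)))).toFinset => (ω j).2 b)) →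
        -- def-T: the 𝐁-terms of the witness at the parent history, READ AT THE EMBEDDED BACKGROUND, are JOINTLY measurable in `(U, A)` (LOCATED residue)
        (∀ (S' : ℕ → Set (Site (F.P p.K) 0)) (j : ℕ) (X : (Sect2.domSys (F.P p.K) θ.τ9.M j).Dom),
          Measurable (fun q : GaugeField (F.P p.K) 0 (SU N) × MSFluct (F.P p.K) (FluctV N) =>
            ((t s.init).B j X (Sect2.ofBackgroundC (settingOfRecord₁₃ F N θ.toStage13Params p).ι q.1) (S', q.2)).re)) →
        (slotsTOfRecord F N θ.ν θ.τ9 (EOfRecord₁₃ F N θ.toStage13Params) (wOfRecord₉ F N θ.toStage9Params) θ.ppSel p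
            (gOfRecord₁₃ F N θ.toStage13Params p) (k + 1) s = 0 ∨
          ∀ᵐ V' ∂fieldMeasure (F.P p.K) (k + 1) (SU N),
            chiSeqOfRecord F N θ.ν θ.τ9.M (gOfRecord₁₃ F N θ.toStage13Params p) p.K (k + 1) s V' ≠ 0 →
              slotsTOfRecord F N θ.ν θ.τ9 (EOfRecord₁₃ F N θ.toStage13Params) (wOfRecord₉ F N θ.toStage9Params) θ.ppSel p
                  (gOfRecord₁₃ F N θ.toStage13Params p) (k + 1) s V' =
                sect2Slot F N (FluctV N) p.K (settingOfRecord₁₃ F N θ.toStage13Params p) (θ.rzAt p s) (WtOfRecord₁₃H F N θ p s) s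
                  (t s.init) (Ek s.init) (UbgOfRecord₁₃CoP F N θ.toStage13Params p (k + 1) s) V') :=
  exists_local_witness_clause_succ_of_sLaw₁₃CoPH_of_bgReadChargedFibre θ p hsep.toCore hU hθ hpos hk hM hw cR Γr hreg
    (bgProvisoΛ_chargedFibre_of_sep_of_junctionFibre θ p hM₁ hle cR Γr (hsep.bg p k hk.le hw hPC) hJ) hS

/-- **★★ THE WITNESS-FIRST FACE AT THE CHARGED SEPARATED INDICES WITH THE JUNCTION ASKED ON THE ITERATED FIBRE ONLY**: keyed on the record row `bg`, the
junction hJ on the fibre at CHARGED SEPARATED indices and `0 < M₁ ≤ M`; conclusion VERBATIM p595777's (no row on the witness). [cite: Balaban1988Convergent, Theorem p.245, Thm 1 p.262, (2.1) p.254, (2.7) p.255, (2.10) p.256, (2.28) p.259, (3.5) p.265, (3.24)–(3.25) p.270; Balaban1985RegularSpaces, (1.3)–(1.6) p.77] -/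
theorem exists_local_witness_clause_succ_of_hasSect2FormAtZS_of_borelB_of_sep_of_junctionFibre (hsep : θ.Provisos₁₃SepCoPH F N) (hU : θ.ZhUnity F N)
    (hθ : θ.Admissible F N) (hpos : θ.s2.Pos) (hM₁ : 0 < θ.ν.M₁) (hle : θ.ν.M₁ ≤ θ.τ9.M) {k : ℕ} (hk : k < p.K) (hM : 1 ≤ θ.τ9.M)
    (hw : Step.InInterval θ.γ k (gOfRecord₁₃ F N θ.toStage13Params p)) (hPC : PartCompat₁₃ F N θ.toStage13Params p k) (cR : ℝ)
    (Γr : SeqOfRecord F θ.ν θ.τ9.M (gOfRecord₁₃ F N θ.toStage13Params p) p.K k → ℕ → Set (Site (F.P p.K) 0) → Set (Site (F.P p.K) 0))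
    (hreg : ∀ s₀, (θ.zhAt p s₀).RegOn F N (FluctV N) θ.ν cR p (gOfRecord₁₃ F N θ.toStage13Params p) (Γr s₀))
    (hJ : ∀ s₀, slotsOfRecord F N θ.ν θ.τ9 (EOfRecord₁₃ F N θ.toStage13Params) (wOfRecord₉ F N θ.toStage9Params) θ.ppSel p
        (gOfRecord₁₃ F N θ.toStage13Params p) k s₀ ≠ 0 → Sect2.SeqSeparated θ.ν.M₁ s₀ → ∀ Wc : MSField (F.P p.K) (SU N),
      chiSeqOfRecord F N θ.ν θ.τ9.M (gOfRecord₁₃ F N θ.toStage13Params p) p.K k s₀ (Wc k) ≠ 0 →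
      (∀ j, j < k → PlaqSmallOn (plaqsOf (pts j (Γr s₀ j (s₀.Ω (j + 1))ᶜ))) (cR * epsOfRecord θ.ν (gOfRecord₁₃ F N θ.toStage13Params p) j) (Wc j)) →
      (∀ j, j < k → ∀ b : PBond (F.P p.K) j, b ∉ bondsIn j (s₀.Ω (j + 1))ᶜ → Wc j b = 1) →
      (∀ j, j < k → ∀ b : PBond (F.P p.K) (j + 1), b ∈ bondsIn (j + 1) (s₀.Ω (j + 1))ᶜ → (avOfRecord F N p.K j).avg (Wc j) b = Wc (j + 1) b) →
      Wc ∈ suppOfRecord₁₃SepCoP F N θ.toStage13Params p k s₀)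
    (t₀ : SeqOfRecord F θ.ν θ.τ9.M (gOfRecord₁₃ F N θ.toStage13Params p) p.K k → Sect2.TermValues (F.P p.K) (MatA N) (FluctV N) θ.τ9.M)
    (E₀ : SeqOfRecord F θ.ν θ.τ9.M (gOfRecord₁₃ F N θ.toStage13Params p) p.K k → ℝ)
    (hform₀ : HasSect2FormAtZS F N (FluctV N) p.K (settingOfRecord₁₃ F N θ.toStage13Params p) k (θ.rzAt p) (WtOfRecord₁₃H F N θ p)
      (UbgOfRecord₁₃CoP F N θ.toStage13Params p k)
      (fun s₀ t' => Sect2.LawsRT (sect2TowerOfRecord F N (FluctV N) p.K (settingOfRecord₁₃ F N θ.toStage13Params p) (θ.rzAt p s₀) s₀ t')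
        (settingOfRecord₁₃ F N θ.toStage13Params p).lf k)
      (slotsOfRecord F N θ.ν θ.τ9 (EOfRecord₁₃ F N θ.toStage13Params) (wOfRecord₉ F N θ.toStage9Params) θ.ppSel p (gOfRecord₁₃ F N θ.toStage13Params p) k) t₀ E₀)
    (hBt : ∀ s₀ (S' : ℕ → Set (Site (F.P p.K) 0)) (j : ℕ) (X : (Sect2.domSys (F.P p.K) θ.τ9.M j).Dom),
      Measurable (fun q : GaugeField (F.P p.K) 0 (SU N) × MSFluct (F.P p.K) (FluctV N) =>
        (t₀ s₀).B j X (Sect2.ofBackgroundC (settingOfRecord₁₃ F N θ.toStage13Params p).ι q.1) (S', q.2))) :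
    ∃ (t : SeqOfRecord F θ.ν θ.τ9.M (gOfRecord₁₃ F N θ.toStage13Params p) p.K k → Sect2.TermValues (F.P p.K) (MatA N) (FluctV N) θ.τ9.M)
      (Ek : SeqOfRecord F θ.ν θ.τ9.M (gOfRecord₁₃ F N θ.toStage13Params p) p.K k → ℝ),
      HasSect2FormAtZS F N (FluctV N) p.K (settingOfRecord₁₃ F N θ.toStage13Params p) k (θ.rzAt p) (WtOfRecord₁₃H F N θ p)
          (UbgOfRecord₁₃CoP F N θ.toStage13Params p k)
          (fun s₀ t₀ => Sect2.LawsRT (sect2TowerOfRecord F N (FluctV N) p.K (settingOfRecord₁₃ F N θ.toStage13Params p) (θ.rzAt p s₀) s₀ t₀)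
            (settingOfRecord₁₃ F N θ.toStage13Params p).lf k)
          (slotsOfRecord F N θ.ν θ.τ9 (EOfRecord₁₃ F N θ.toStage13Params) (wOfRecord₉ F N θ.toStage9Params) θ.ppSel p
            (gOfRecord₁₃ F N θ.toStage13Params p) k) t Ek ∧
      (∀ s₀, IsFluctLocal k (t s₀)) ∧
      ∀ (s : SeqOfRecord F θ.ν θ.τ9.M (gOfRecord₁₃ F N θ.toStage13Params p) p.K (k + 1)), s.Ω (k + 1) = ∅ →
        -- (P) prefix agreement below `k`
        (∀ j, j < k → (θ.zhAt p s).ζ0 j = (θ.zhAt p s.init).ζ0 j ∧ (θ.zhAt p s).quad j = (θ.zhAt p s.init).quad j) →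
        -- (V) the generation-`k` pin with the old front factor
        (∀ (V' : GaugeField (F.P p.K) (k + 1) (SU N)) (U₀ : GaugeField (F.P p.K) k (SU N)),
          (θ.zhAt p s).ζ0 k Set.univ (pairCfgAt (V := FluctV N) k V' U₀) =
            chiSeqOfRecord F N θ.ν θ.τ9.M (gOfRecord₁₃ F N θ.toStage13Params p) p.K k s.init U₀ *
              wOfRecord₉ F N θ.toStage9Params p (gOfRecord₁₃ F N θ.toStage13Params p) k s U₀ ((avOfRecord F N p.K k).avg U₀)) →
        -- `quad_k(∅) = 0` on the two-scale configurations
        (∀ (V' : GaugeField (F.P p.K) (k + 1) (SU N)) (U₀ : GaugeField (F.P p.K) k (SU N)), (θ.zhAt p s).quad k ∅ (pairCfgAt (V := FluctV N) k V' U₀) = 0) →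
        -- `k`-locality of `quad_j(Λ_{j+1})`, `j < k`
        (∀ j, j < k → ∀ ω ω' : MultiCfg (F.P p.K) (SU N) (FluctV N), (∀ i, i ≤ k → ω i = ω' i) →
          (θ.zhAt p s).quad j (s.init.Λ (j + 1)) ω = (θ.zhAt p s).quad j (s.init.Λ (j + 1)) ω') →
        -- measurability of the residual serving `s′`
        (∀ j (Y : Set (Site (F.P p.K) 0)), Measurable ((θ.zhAt p s).ζ0 j Y)) →
        (∀ j (Λ' : Set (Site (F.P p.K) 0)), Measurable ((θ.zhAt p s).quad j Λ')) →
        -- per old branch: A-fibre domination (K0b)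
        (∀ S ∈ admSOfRecord F θ.ν θ.τ9.M (gOfRecord₁₃ F N θ.toStage13Params p) p.K k s.init, ∀ j : ℕ,
          ∃ ŵ : (↥(Set.toFinite (B10Eq42TorusConstraint.bondsIn j ((s.init.Λ (j + 1))ᶜ ∩ s.init.Ω (j + 1)))).toFinset → FluctV N) → ℝ≥0∞, Measurable ŵ ∧
            (∫⁻ a, ŵ a ∂(Measure.pi fun _ : ↥(Set.toFinite (B10Eq42TorusConstraint.bondsIn j ((s.init.Λ (j + 1))ᶜ ∩ s.init.Ω (j + 1)))).toFinset => (volume : Measure (FluctV N)))) ≠ ⊤ ∧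
            ∀ ω, ENNReal.ofReal ((WtOfRecord₁₃H F N θ p s).w j (s.init.Λ (j + 1)) ((s.init.Λ (j + 1))ᶜ ∩ s.init.Ω (j + 1)) (S (j + 1)) ω) ≤
              ŵ (fun b : ↥(Set.toFinite (B10Eq42TorusConstraint.bondsIn j ((s.init.Λ (j + 1))ᶜ ∩ s.init.Ω (j + 1)))).toFinset => (ω j).2 b)) →
        (slotsTOfRecord F N θ.ν θ.τ9 (EOfRecord₁₃ F N θ.toStage13Params) (wOfRecord₉ F N θ.toStage9Params) θ.ppSel p
            (gOfRecord₁₃ F N θ.toStage13Params p) (k + 1) s = 0 ∨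
          ∀ᵐ V' ∂fieldMeasure (F.P p.K) (k + 1) (SU N),
            chiSeqOfRecord F N θ.ν θ.τ9.M (gOfRecord₁₃ F N θ.toStage13Params p) p.K (k + 1) s V' ≠ 0 →
              slotsTOfRecord F N θ.ν θ.τ9 (EOfRecord₁₃ F N θ.toStage13Params) (wOfRecord₉ F N θ.toStage9Params) θ.ppSel p
                  (gOfRecord₁₃ F N θ.toStage13Params p) (k + 1) s V' =
                sect2Slot F N (FluctV N) p.K (settingOfRecord₁₃ F N θ.toStage13Params p) (θ.rzAt p s) (WtOfRecord₁₃H F N θ p s) s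
                  (t s.init) (Ek s.init) (UbgOfRecord₁₃CoP F N θ.toStage13Params p (k + 1) s) V') :=
  exists_local_witness_clause_succ_of_hasSect2FormAtZS_of_borelB_of_bgReadChargedFibre θ p hsep.toCore hU hθ hpos hk hM hw cR Γr hreg
    (bgProvisoΛ_chargedFibre_of_sep_of_junctionFibre θ p hM₁ hle cR Γr (hsep.bg p k hk.le hw hPC) hJ) t₀ E₀ hform₀ hBt

end Summit.QuantumFields.YangMills.Theorems.BalabanUVNodesN11ChargedSepJunctionFibre

end
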